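import Summits.Ventures.CertifiedManyBodySolver.Observables.CrutchODLROFloor
import HarnessLib

/-!
# BCS-crutch ODLRO floor: the PLATEAU beyond `2g₀` (card `bcs-crutch-odlro-floor`, FN14a)

HONEST FRAMING: first certified bounds; not a superconductivity verdict; every number certified or labelled
float. WHAT THIS IS NOT: a statement about the Hubbard model — `H_g = K_L − μN − (g/L²) Δ_d†Δ_d` is the
BCS-CRUTCH Hamiltonian `crutchTorusTT'` of `Observables/CrutchODLROFloor.lean` (p484664); at `g = 0` NOTHING
is claimed; grand canonical at one `μ`, density NOT pinned; a thermometer / corollary column beside the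
pinning-field chord rows, never a B1 entry, no phase word; no number enters a statement here.

THE PLATEAU (hubbard-pc-lens-finite-1, card ADDENDUM g4 §2 = FN14a; arithmetic cores kernel-checked seat-side
in `pub/hubbard-cq/lean/finite1-CrutchFloorTT.lean` 40c1c2a7124effd8, operator level landed here by
hubbard-cq-p2). P1-GC (`crutchODLROFloorGC_holds`) reads the two `T = 0` cells — zero-field floor
`lo·L² ≤ E₀(K_L − μN)` and sourced cap `E₀(A_L(h₀)) ≤ hi·L²` — as the floor `(G − h₀²/g)/g ≤ pairLRO L ψ`,
`G = lo − hi`, which DECAYS like `G/g` for large `g`. The same two cells give more: for every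
`g ≥ 2g₀ = 2h₀²/G` and every unit ground-state vector `ψ` of `H_g`,

  `(G/(2h₀))² ≤ pairLRO L ψ`        (`crutchODLROFloor_plateau`),

i.e. the certified floor SATURATES at the squared chord slope `m_lo² = (G/(2h₀))²` (the square of the certified
response floor of the chord) and never decays. Chain (five tree facts, nothing else): with `v ≠ 0` a ground
vector of `A(h₀)`, `n = ‖v‖²`, `R = Re⟨v, Δ_d v⟩`, `P = ‖Δ_d v‖²`: (i) `v` trial for `A(0) = A(h₀) + h₀(Δ_d+Δ_d†)`:
`E₀(A(0))·n ≤ E₀(A(h₀))·n + 2h₀R`, so with the cells `R/n ≥ G L²/(2h₀)` (the chord bracket); (ii) `v` trial for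
`H_g`: `E₀(H_g)·n ≤ E₀(A(h₀))·n + 2h₀R − (g/L²)P`; (iii) Cauchy–Schwarz `R² ≤ nP` (the completed square
`re_completeSquare_nonneg` at `b = R/n`); (iv) `ψ` trial for `A(0)`: `E₀(A(0)) ≤ E₀(H_g) + (g/L²)X`,
`X = Re⟨ψ, Δ_d†Δ_d ψ⟩` (`re_zeroField_rayleigh_of_crutch_groundState`); (v) the two cells. Hence
`(g/L²)X ≥ G L² − 2h₀m + (g/L²)m²` with `m = R/n ≥ G L²/(2h₀) ≥ h₀L²/g` (the vertex) when `g ≥ 2h₀²/G`, and the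
quadratic is increasing beyond its vertex: `X ≥ m_lo²·L⁴`. Together with `crutchFloor_le_chordSlope_sq`
(the P1-GC floor never exceeds `(G/2h₀)²`) the certified crutch floor as a function of `g` is: the card floor
`(G − h₀²/g)/g` on `(g₀, 2g₀]`, the constant `(G/2h₀)²` on `[2g₀, ∞)` — «does-not-give» column unchanged: no bit
beyond the chord (critic-2 / transplant-1 BN-T1; obst-2's remark `K(g)/g` non-decreasing).

Contents: the real-arithmetic core `crutchPlateau_core`; the homogeneous trial-vector facts
`re_rayleigh_zeroField_eq_of_mem_groundSpace` / `re_rayleigh_crutch_eq_of_trial`; the plateau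
`crutchODLROFloor_plateau` (one torus, cells as hypotheses, `0 < h₀`, `0 < g`, `2h₀² ≤ g·G`); the by-name reader
on two uniform cells with their own `(q, L₀)` (`crutchODLROFloor_plateau_of_rows`). Same local `DecidableEq`
pin as the row file. No `sorry`, no named fact, no new definition besides the pin.

References: J. Bardeen, L. N. Cooper, J. R. Schrieffer, Phys. Rev. 108 (1957) 1175, §II; C. N. Yang, Rev.
Mod. Phys. 34 (1962) 694, §4 (ODLRO; `|⟨Δ⟩|² ≤ ⟨Δ†Δ⟩`); H. Tasaki, *Physics and Mathematics of Quantum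
Many-Body Systems* (2020), §2.1 (variational principle); R. B. Griffiths, Phys. Rev. 152 (1966) 240, §II
(concavity chords).
-/

noncomputable section

namespace Summit.Ventures.CertifiedManyBodySolver.Observables

open Literature.MathematicalPhysics.QuantumLattice Summit.Ventures.CertifiedManyBodySolver
open Matrix HubbardWave0 Literature.Probability.LatticeModels Finset
open scoped BigOperators ComplexOrder

/-- Same local instance as `Rows/SourcedTorusRows.lean` and `Observables/CrutchODLROFloor.lean`, so that
`crutchTorusTT' L tp U μ g` / `.groundSpace` / `.groundEnergy` elaborate with the SAME `DecidableEq` path as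
P1-GC (another path is propositionally equal but defeq-unification of the two chains does not terminate). -/
local instance (priority := high) instDecidableEqFermionTorusCrutchPlateau {L : ℕ} :
    DecidableEq (FermionTorus 2 L) :=
  LinearOrder.toDecidableEq

variable {L : ℕ} [NeZero L]

/-! ## §1 Real-arithmetic core -/

/-- **Plateau core.** With `N = L² > 0`, `h₀ > 0`, `g > 0`: the chord bracket `G·N ≤ 2h₀·m`, the master
inequality `G·N − 2h₀·m + (g/N)·m² ≤ (g/N)·X` and the regime `2h₀² ≤ g·G` give `(G·N/(2h₀))² ≤ X`
(the quadratic in `m` is increasing beyond its vertex `h₀N/g ≤ G N/(2h₀) ≤ m`). -/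
theorem crutchPlateau_core {G g h0 N m X : ℝ} (hh0 : 0 < h0) (hg : 0 < g) (hN : 0 < N)
    (hbr : G * N ≤ 2 * h0 * m) (hmaster : G * N - 2 * h0 * m + g / N * m ^ 2 ≤ g / N * X)
    (hreg : 2 * h0 ^ 2 ≤ g * G) : (G * N / (2 * h0)) ^ 2 ≤ X := by
  -- write m = m_lo + d with d ≥ 0, m_lo = G N/(2h₀)
  set mlo : ℝ := G * N / (2 * h0) with hmlo
  have hmlo' : 2 * h0 * mlo = G * N := by rw [hmlo]; field_simp
  have hd : 0 ≤ m - mlo := by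
    have : 2 * h0 * mlo ≤ 2 * h0 * m := by rw [hmlo']; exact hbr
    nlinarith
  -- the slope factor 2·m_lo − 2h₀N/g ≥ 0 in the regime
  have hslope : 0 ≤ g / N * (m + mlo) - 2 * h0 := by
    have h1 : mlo + mlo ≤ m + mlo := by linarith
    have h2 : 2 * h0 ≤ g / N * (mlo + mlo) := by
      rw [hmlo]
      have : g / N * (G * N / (2 * h0) + G * N / (2 * h0)) = g * G / h0 := by
        field_simp
        ring
      rw [this, le_div_iff₀ hh0]
      nlinarith
    have h3 : g / N * (mlo + mlo) ≤ g / N * (m + mlo) :=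
      mul_le_mul_of_nonneg_left h1 (div_pos hg hN).le
    linarith
  -- q(m) − q(m_lo) = (m − m_lo)·((g/N)(m + m_lo) − 2h₀) ≥ 0 and q(m_lo) = (g/N)·m_lo²
  have hq : g / N * mlo ^ 2 ≤ g / N * X := by
    have hmono : 0 ≤ (m - mlo) * (g / N * (m + mlo) - 2 * h0) := mul_nonneg hd hslope
    have e : G * N - 2 * h0 * m + g / N * m ^ 2 =
        g / N * mlo ^ 2 + (m - mlo) * (g / N * (m + mlo) - 2 * h0) + (G * N - 2 * h0 * mlo) := by ring
    rw [e, hmlo'] at hmaster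
    linarith
  exact le_of_mul_le_mul_left hq (div_pos hg hN)

/-! ## §2 Trial-vector identities for a ground vector of the sourced Hamiltonian -/

/-- `Re⟨v, A(0) v⟩ = Re⟨v, A(h) v⟩ + 2h·Re⟨v, Δ_d v⟩` for every vector `v` (`A(h) = A(0) − h(Δ_d + Δ_d†)`,
`Re⟨v, Δ_d† v⟩ = Re⟨v, Δ_d v⟩`). -/
theorem re_rayleigh_zeroField_eq_add (tp U μ h : ℝ) (v : Fock (Orb (FermionTorus 2 L))) :
    (star v ⬝ᵥ dWaveSourceTorusTT' L tp U μ 0 *ᵥ v).re =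
      (star v ⬝ᵥ dWaveSourceTorusTT' L tp U μ h *ᵥ v).re +
        2 * h * (star v ⬝ᵥ pairField dWaveFormFactor L *ᵥ v).re := by
  have hsub : dWaveSourceTorusTT' L tp U μ h = dWaveSourceTorusTT' L tp U μ 0 -
      (h : ℂ) • (pairField dWaveFormFactor L + (pairField dWaveFormFactor L)ᴴ) := by
    unfold dWaveSourceTorusTT'
    simp
  rw [hsub, sub_mulVec, smul_mulVec, add_mulVec, dotProduct_sub, dotProduct_smul, dotProduct_add,
    smul_eq_mul, Complex.sub_re, Complex.mul_re, Complex.add_re, Complex.add_im, Complex.ofReal_re,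
    Complex.ofReal_im, zero_mul, sub_zero, re_dotProduct_conjTranspose_mulVec_eq]
  ring

/-- `Re⟨v, H_g v⟩ = Re⟨v, A(0) v⟩ − (g/L²)·Re⟨v, Δ_d†Δ_d v⟩` for every vector `v`. -/
theorem re_rayleigh_crutch_eq_sub (tp U μ g : ℝ) (v : Fock (Orb (FermionTorus 2 L))) :
    (star v ⬝ᵥ crutchTorusTT' L tp U μ g *ᵥ v).re =
      (star v ⬝ᵥ dWaveSourceTorusTT' L tp U μ 0 *ᵥ v).re -
        g / (L : ℝ) ^ 2 * (star v ⬝ᵥ pairSq L *ᵥ v).re := by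
  rw [crutchTorusTT', sub_mulVec, smul_mulVec, dotProduct_sub, dotProduct_smul, smul_eq_mul,
    Complex.sub_re, Complex.mul_re, Complex.ofReal_re, Complex.ofReal_im, zero_mul, sub_zero]

/-- Cauchy–Schwarz in the form used here: `(Re⟨v, Δ v⟩)² ≤ Re⟨v, v⟩ · Re⟨v, Δ†Δ v⟩` for `v ≠ 0`
(the completed square `re_completeSquare_nonneg` at `b = R/‖v‖²`). -/
theorem re_rayleigh_sq_le_mul_re_rayleigh_sq {n : Type*} [Fintype n] (M : Matrix n n ℂ) (v : n → ℂ)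
    (hv : 0 < (star v ⬝ᵥ v).re) :
    (star v ⬝ᵥ M *ᵥ v).re ^ 2 ≤ (star v ⬝ᵥ v).re * (star v ⬝ᵥ (Mᴴ * M) *ᵥ v).re := by
  set nv : ℝ := (star v ⬝ᵥ v).re
  set R : ℝ := (star v ⬝ᵥ M *ᵥ v).re
  set P : ℝ := (star v ⬝ᵥ (Mᴴ * M) *ᵥ v).re
  have h := re_completeSquare_nonneg M v (R / nv)
  -- h : 0 ≤ P − 2(R/n)R + (R/n)² n = P − R²/n
  have e : P - 2 * (R / nv) * R + (R / nv) ^ 2 * nv = P - R ^ 2 / nv := by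
    field_simp
    ring
  rw [e] at h
  have h' : R ^ 2 / nv ≤ P := by linarith
  rwa [div_le_iff₀ hv, mul_comm] at h'

/-! ## §3 The plateau -/

/-- **PLATEAU of the crutch ODLRO floor (FN14a).** On one torus, from the two `T = 0` cells — zero-field floor
`lo·L² ≤ E₀(K_L − μN)` and sourced cap `E₀(A_L(h₀)) ≤ hi·L²` at a field `h₀ > 0` — for every crutch strength
`g > 0` in the regime `2h₀² ≤ g·(lo − hi)` (i.e. `g ≥ 2g₀`, `g₀ = h₀²/(lo − hi)`) and every unit ground-state
vector `ψ` of `H_g = crutchTorusTT' L tp U μ g`: `((lo − hi)/(2h₀))² ≤ pairLRO L ψ`. Class: GC Fock space at one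
`μ`, one finite torus; density unpinned; BCS-crutch thermometer, not Hubbard. -/
theorem crutchODLROFloor_plateau {tp U μ h0 : ℝ} {lo hi : ℚ} (hh0 : 0 < h0)
    (hlo : SourcedTorusEnergyLowerRow L tp U μ 0 lo) (hhi : SourcedTorusEnergyUpperRow L tp U μ h0 hi)
    {g : ℝ} (hg : 0 < g) (hreg : 2 * h0 ^ 2 ≤ g * (((lo : ℚ) : ℝ) - ((hi : ℚ) : ℝ)))
    (ψ : Fock (Orb (FermionTorus 2 L))) (hψ : star ψ ⬝ᵥ ψ = 1)
    (hGS : ψ ∈ (crutchTorusTT' L tp U μ g).groundSpace) :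
    ((((lo : ℚ) : ℝ) - ((hi : ℚ) : ℝ)) / (2 * h0)) ^ 2 ≤ pairLRO L ψ := by
  unfold SourcedTorusEnergyLowerRow at hlo
  unfold SourcedTorusEnergyUpperRow at hhi
  have hL : (0 : ℝ) < (L : ℝ) := by exact_mod_cast Nat.pos_of_ne_zero (NeZero.ne L)
  have hN : (0 : ℝ) < (L : ℝ) ^ 2 := by positivity
  have hL4 : (0 : ℝ) < (L : ℝ) ^ 4 := by positivity
  set G : ℝ := ((lo : ℚ) : ℝ) - ((hi : ℚ) : ℝ) with hG
  -- a nonzero ground vector v of A(h₀)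
  have hAh : (dWaveSourceTorusTT' L tp U μ h0).IsHermitian := dWaveSourceTorusTT'_isHermitian L tp U μ h0
  have hA0 : (dWaveSourceTorusTT' L tp U μ 0).IsHermitian := dWaveSourceTorusTT'_isHermitian L tp U μ 0
  have hH : (crutchTorusTT' L tp U μ g).IsHermitian := crutchTorusTT'_isHermitian (L := L) tp U μ g
  obtain ⟨v, hv, hv0⟩ := (Submodule.ne_bot_iff _).1 (groundSpace_ne_bot_holds hAh)
  have hnv : 0 < (star v ⬝ᵥ v).re := (Complex.pos_iff.mp (dotProduct_star_self_pos_iff.mpr hv0)).1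
  -- (iii) Cauchy–Schwarz R² ≤ n·P (stated before the abbreviations are introduced)
  have h3 : (star v ⬝ᵥ pairField dWaveFormFactor L *ᵥ v).re ^ 2 ≤
      (star v ⬝ᵥ v).re * (star v ⬝ᵥ pairSq L *ᵥ v).re :=
    re_rayleigh_sq_le_mul_re_rayleigh_sq (pairField dWaveFormFactor L) v hnv
  set nv : ℝ := (star v ⬝ᵥ v).re with hnvdef
  set R : ℝ := (star v ⬝ᵥ pairField dWaveFormFactor L *ᵥ v).re with hR
  set P : ℝ := (star v ⬝ᵥ pairSq L *ᵥ v).re with hP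
  set X : ℝ := (star ψ ⬝ᵥ pairSq L *ᵥ ψ).re with hX
  -- Re⟨v, A(h₀) v⟩ = E₀(A(h₀))·n
  have hvAh : (star v ⬝ᵥ dWaveSourceTorusTT' L tp U μ h0 *ᵥ v).re =
      (dWaveSourceTorusTT' L tp U μ h0).groundEnergy * nv := re_rayleigh_of_mem_groundSpace hv
  -- (i) v trial for A(0): E₀(A0)·n ≤ E₀(A h₀)·n + 2h₀R
  have h1 : (dWaveSourceTorusTT' L tp U μ 0).groundEnergy * nv ≤
      (dWaveSourceTorusTT' L tp U μ h0).groundEnergy * nv + 2 * h0 * R := by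
    have := groundEnergy_mul_le_re_quadForm hA0 v
    rw [re_rayleigh_zeroField_eq_add tp U μ h0 v, hvAh] at this
    exact this
  -- (ii) v trial for H_g: E₀(H_g)·n ≤ E₀(A h₀)·n + 2h₀R − (g/L²)P
  have h2 : (crutchTorusTT' L tp U μ g).groundEnergy * nv ≤
      (dWaveSourceTorusTT' L tp U μ h0).groundEnergy * nv + 2 * h0 * R - g / (L : ℝ) ^ 2 * P := by
    have := groundEnergy_mul_le_re_quadForm hH v
    rw [re_rayleigh_crutch_eq_sub tp U μ g v, re_rayleigh_zeroField_eq_add tp U μ h0 v, hvAh] at this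
    exact this
  -- (iv) ψ trial for A(0): E₀(A0) ≤ E₀(H_g) + (g/L²)X
  have h4 : (dWaveSourceTorusTT' L tp U μ 0).groundEnergy ≤
      (crutchTorusTT' L tp U μ g).groundEnergy + g / (L : ℝ) ^ 2 * X := by
    have := Matrix.groundEnergy_le_rayleigh_holds hA0 ψ hψ
    rwa [re_zeroField_rayleigh_of_crutch_groundState hψ hGS] at this
  -- per-unit-norm quantities m = R/n, and the three inequalities of the core
  set m : ℝ := R / nv with hm
  have hRm : R = m * nv := by rw [hm]; field_simp
  have hbr : G * (L : ℝ) ^ 2 ≤ 2 * h0 * m := by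
    -- from (i) and the cells, divided by n
    have hc : ((lo : ℚ) : ℝ) * (L : ℝ) ^ 2 * nv ≤ (((hi : ℚ) : ℝ) * (L : ℝ) ^ 2) * nv + 2 * h0 * R := by
      have a := mul_le_mul_of_nonneg_right hlo hnv.le
      have b := mul_le_mul_of_nonneg_right hhi hnv.le
      linarith
    rw [hRm] at hc
    have : (G * (L : ℝ) ^ 2) * nv ≤ (2 * h0 * m) * nv := by rw [hG]; nlinarith
    exact le_of_mul_le_mul_right this hnv
  have hmaster : G * (L : ℝ) ^ 2 - 2 * h0 * m + g / (L : ℝ) ^ 2 * m ^ 2 ≤ g / (L : ℝ) ^ 2 * X := by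
    -- from (ii)+(iii): E₀(H_g) ≤ E₀(A h₀) + 2h₀ m − (g/L²) m²; then (iv) and the cells
    have hP' : m ^ 2 * nv ≤ P := by
      have : m ^ 2 * nv = R ^ 2 / nv := by rw [hm]; field_simp
      rw [this, div_le_iff₀ hnv]
      linarith [h3]
    have h2' : (crutchTorusTT' L tp U μ g).groundEnergy ≤
        (dWaveSourceTorusTT' L tp U μ h0).groundEnergy + 2 * h0 * m - g / (L : ℝ) ^ 2 * m ^ 2 := by
      have hgN : 0 ≤ g / (L : ℝ) ^ 2 := (div_pos hg hN).le
      have step : (crutchTorusTT' L tp U μ g).groundEnergy * nv ≤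
          ((dWaveSourceTorusTT' L tp U μ h0).groundEnergy + 2 * h0 * m - g / (L : ℝ) ^ 2 * m ^ 2) * nv := by
        have := mul_le_mul_of_nonneg_left hP' hgN
        rw [hRm] at h2
        nlinarith
      exact le_of_mul_le_mul_right step hnv
    have : ((lo : ℚ) : ℝ) * (L : ℝ) ^ 2 ≤
        ((hi : ℚ) : ℝ) * (L : ℝ) ^ 2 + 2 * h0 * m - g / (L : ℝ) ^ 2 * m ^ 2 + g / (L : ℝ) ^ 2 * X := by
      linarith
    rw [hG]
    linarith
  have hcore := crutchPlateau_core (N := (L : ℝ) ^ 2) hh0 hg hN hbr hmaster (by rw [hG]; exact hreg)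
  -- (G L²/(2h₀))² ≤ X  ⇒  (G/(2h₀))² ≤ X/L⁴
  unfold pairLRO
  rw [← hX, le_div_iff₀ hL4]
  have e : (G / (2 * h0)) ^ 2 * (L : ℝ) ^ 4 = (G * (L : ℝ) ^ 2 / (2 * h0)) ^ 2 := by ring
  rw [e]
  exact hcore

/-- **By-name reader** (corollary column, plateau): a zero-field floor cell on `(q₁, L₁)` and a sourced cap cell
at `h₀ > 0` on `(q₂, L₂)` give, on every torus both cells reach and for every `g` with `2h₀² ≤ g·(lo − hi)`,
the `g`-independent floor `((lo − hi)/(2h₀))² ≤ pairLRO L ψ` for every unit ground-state vector of `H_g`. -/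
theorem crutchODLROFloor_plateau_of_rows {tp U μ h0 : ℝ} {q₁ q₂ L₁ L₂ : ℕ} {lo hi : ℚ} (hh0 : 0 < h0)
    (hlo : SourcedEnergyLowerRow tp U μ 0 q₁ L₁ lo) (hhi : SourcedEnergyUpperRow tp U μ h0 q₂ L₂ hi)
    (L : ℕ) [NeZero L] (hL₁ : L₁ ≤ L) (hL₂ : L₂ ≤ L) (hq₁ : q₁ ∣ L) (hq₂ : q₂ ∣ L)
    {g : ℝ} (hg : 0 < g) (hreg : 2 * h0 ^ 2 ≤ g * (((lo : ℚ) : ℝ) - ((hi : ℚ) : ℝ)))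
    (ψ : Fock (Orb (FermionTorus 2 L))) (hψ : star ψ ⬝ᵥ ψ = 1)
    (hGS : ψ ∈ (crutchTorusTT' L tp U μ g).groundSpace) :
    ((((lo : ℚ) : ℝ) - ((hi : ℚ) : ℝ)) / (2 * h0)) ^ 2 ≤ pairLRO L ψ :=
  crutchODLROFloor_plateau hh0 (hlo L hL₁ hq₁) (hhi L hL₂ hq₂) hg hreg ψ hψ hGS

/-- The certified crutch floor as a function of `g` (both branches from the same two cells): the P1-GC floor
`(G − h₀²/g)/g` for every `g > 0`, and the plateau `(G/(2h₀))²` once `2h₀² ≤ g·G` — the latter dominates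
there (`crutchFloor_le_chordSlope_sq`), so the floor is non-decreasing in `g` and never exceeds the squared
chord slope. -/
theorem crutchODLROFloor_both_of_rows {tp U μ h0 : ℝ} {q₁ q₂ L₁ L₂ : ℕ} {lo hi : ℚ} (hh0 : 0 < h0)
    (hlo : SourcedEnergyLowerRow tp U μ 0 q₁ L₁ lo) (hhi : SourcedEnergyUpperRow tp U μ h0 q₂ L₂ hi)
    (L : ℕ) [NeZero L] (hL₁ : L₁ ≤ L) (hL₂ : L₂ ≤ L) (hq₁ : q₁ ∣ L) (hq₂ : q₂ ∣ L)
    {g : ℝ} (hg : 0 < g) (ψ : Fock (Orb (FermionTorus 2 L))) (hψ : star ψ ⬝ᵥ ψ = 1)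
    (hGS : ψ ∈ (crutchTorusTT' L tp U μ g).groundSpace) :
    (((lo : ℚ) : ℝ) - ((hi : ℚ) : ℝ) - h0 ^ 2 / g) / g ≤ pairLRO L ψ ∧
      (2 * h0 ^ 2 ≤ g * (((lo : ℚ) : ℝ) - ((hi : ℚ) : ℝ)) →
        ((((lo : ℚ) : ℝ) - ((hi : ℚ) : ℝ)) / (2 * h0)) ^ 2 ≤ pairLRO L ψ) :=
  ⟨crutchODLROFloor_of_rows hlo hhi L hL₁ hL₂ hq₁ hq₂ hg ψ hψ hGS,
    fun hreg => crutchODLROFloor_plateau_of_rows hh0 hlo hhi L hL₁ hL₂ hq₁ hq₂ hg hreg ψ hψ hGS⟩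

end Summit.Ventures.CertifiedManyBodySolver.Observables
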